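import Mathlib
import HarnessLib
import Summits.AtomisticToContinuum.HydrodynamicLimit.Theorems.MourreKoopmanChargesOneBodyCompletenessTorusMoments

/-!
# `OneBodyCompleteness` · line `torus_fejer` v2, stub `stub_profileDensityAll`, part A:
# bounded continuous profiles `⊥ {1, v, |v|²}` are `L²(M_θ)`-dense among all such profiles

Support file for the crux item stmt-AtomisticToContinuum-9583 (`OneBodyCompleteness`, route
`MourreKoopmanCharges` of `AtomisticToContinuum/HydrodynamicLimit`), line `torus_fejer` (v2), stub
`stub_profileDensityAll` — the static (velocity-space) half.

Claim (`exists_bdd_cont_orth_five`): for `θ > 0`, a continuous polynomially bounded velocity profile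
`h : ℝ³ → ℝ` which is `M_θ`-orthogonal to the five collision invariants `1, v₁, v₂, v₃, |v|²` and
`ε > 0`, there is a BOUNDED continuous `g`, `M_θ`-orthogonal to the same five functions, with
`∫ (h - g)² M_θ dv ≤ ε`.

Proof: work in `L²(μ)`, `μ = gaussMeasure 0 θ` (density `M_θ`, `integral_gaussMeasure_eq_integral_mul`).
Bounded continuous functions are dense in `L²(μ)` (Mathlib,
`MemLp.exists_boundedContinuous_integral_rpow_sub_le`; `μ` is a finite Borel measure on `ℝ³`).  A
dense subspace meets the common kernel of finitely many continuous linear functionals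
`φ_e(f) = ∫ f e dμ` (`e ∈ L²(μ)`) densely: by induction on the list of functionals, correct an
approximant `b ⊥ E_prev` of `h` by a multiple of a fixed bounded continuous `b₀ ⊥ E_prev` with
`φ_e(b₀) ≠ 0` (if there is none, `φ_e` vanishes on the approximants and nothing is to be done); the
cost is controlled by Cauchy–Schwarz, `φ_e(b) = φ_e(b - h)`, `|φ_e(b - h)|² ≤ ‖h - b‖² ‖e‖²`.

References: folklore functional analysis (finite-codimension density); H. Spohn, *Large Scale
Dynamics of Interacting Particles* (1991), Part II §7.1 for the role of the collision invariants.
-/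

noncomputable section

namespace Summit.AtomisticToContinuum.HydrodynamicLimit.Theorems.MourreKoopmanChargesOneBodyCompleteness

open MeasureTheory ProbabilityTheory Filter Topology Set
open scoped ENNReal BigOperators
open Literature.Analysis.FluidPDE Literature.MathematicalPhysics.KineticTheory
open Summit.AtomisticToContinuum.HydrodynamicLimit.Theorems.MourreKoopmanChargesIdealGasNoDecay

namespace stub_profileDensityAllAux

/-! ### Abstract `L²` pieces -/

/-- Cauchy–Schwarz for two `L²` functions, squared form: `(∫ u e)² ≤ (∫ u²) (∫ e²)`
(discriminant of `t ↦ ∫ (t u + e)² ≥ 0`). [folklore] -/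
theorem sq_integral_mul_le {α : Type*} [MeasurableSpace α] {μ : Measure α} {u e : α → ℝ}
    (hu : MemLp u 2 μ) (he : MemLp e 2 μ) :
    (∫ x, u x * e x ∂μ) ^ 2 ≤ (∫ x, u x ^ 2 ∂μ) * ∫ x, e x ^ 2 ∂μ := by
  have hue : Integrable (fun x => u x * e x) μ := hu.integrable_mul he
  have hu2 : Integrable (fun x => u x ^ 2) μ := hu.integrable_sq
  have he2 : Integrable (fun x => e x ^ 2) μ := he.integrable_sq
  have hq : ∀ t : ℝ,
      0 ≤ (∫ x, u x ^ 2 ∂μ) * (t * t) + (2 * ∫ x, u x * e x ∂μ) * t + ∫ x, e x ^ 2 ∂μ := by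
    intro t
    have h1 : ∫ x, (t * u x + e x) ^ 2 ∂μ =
        ∫ x, ((t * t) * u x ^ 2 + (2 * t) * (u x * e x) + e x ^ 2) ∂μ :=
      integral_congr_ae (Eventually.of_forall fun x => by ring)
    have h2 : (∫ x, u x ^ 2 ∂μ) * (t * t) + (2 * ∫ x, u x * e x ∂μ) * t + ∫ x, e x ^ 2 ∂μ =
        ∫ x, (t * u x + e x) ^ 2 ∂μ := by
      have hA : Integrable (fun x => (t * t) * u x ^ 2 + (2 * t) * (u x * e x)) μ :=
        (hu2.const_mul _).add (hue.const_mul _)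
      rw [h1, integral_add hA he2, integral_add (hu2.const_mul _) (hue.const_mul _),
        integral_const_mul, integral_const_mul]
      ring
    rw [h2]
    exact integral_nonneg fun x => sq_nonneg _
  have hd := discrim_le_zero hq
  rw [discrim] at hd
  nlinarith [hd]

/-- Bounded continuous functions are dense in `L²(μ)` for a finite Borel measure `μ` on `ℝ³`
(Mathlib's `MemLp.exists_boundedContinuous_integral_rpow_sub_le`, squared-distance form). [folklore] -/
theorem exists_bdd_cont_sq_le (μ : Measure V3) [IsFiniteMeasure μ] {h : V3 → ℝ}
    (hh : MemLp h 2 μ) {η : ℝ} (hη : 0 < η) :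
    ∃ b : V3 → ℝ, Continuous b ∧ (∃ K : ℝ, ∀ v, |b v| ≤ K) ∧ MemLp b 2 μ ∧
      ∫ v, (h v - b v) ^ 2 ∂μ ≤ η := by
  have hh' : MemLp h (ENNReal.ofReal 2) μ := by rwa [ENNReal.ofReal_ofNat]
  obtain ⟨g, hg, hg2⟩ := hh'.exists_boundedContinuous_integral_rpow_sub_le two_pos hη
  rw [ENNReal.ofReal_ofNat] at hg2
  refine ⟨g, g.continuous, ⟨‖g‖, fun v => ?_⟩, hg2, le_of_eq_of_le ?_ hg⟩
  · rw [← Real.norm_eq_abs]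
    exact g.norm_coe_le_norm v
  · refine integral_congr_ae (Eventually.of_forall fun v => ?_)
    simp only
    rw [Real.rpow_two, Real.norm_eq_abs, sq_abs]

/-- **Finite-codimension density.** For `h ∈ L²(μ)` orthogonal to a finite list `L ⊆ L²(μ)` of
test functions and `η > 0` there is a bounded continuous `b`, orthogonal to every `e ∈ L`, with
`∫ (h - b)² dμ ≤ η` (induction on `L`: correct the approximant one functional at a time). [folklore] -/
theorem exists_bdd_cont_orth (μ : Measure V3) [IsFiniteMeasure μ] {h : V3 → ℝ}
    (hh : MemLp h 2 μ) :
    ∀ L : List (V3 → ℝ), (∀ e ∈ L, MemLp e 2 μ) → (∀ e ∈ L, ∫ v, h v * e v ∂μ = 0) →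
      ∀ η : ℝ, 0 < η → ∃ b : V3 → ℝ, Continuous b ∧ (∃ K : ℝ, ∀ v, |b v| ≤ K) ∧ MemLp b 2 μ ∧
        (∀ e ∈ L, ∫ v, b v * e v ∂μ = 0) ∧ ∫ v, (h v - b v) ^ 2 ∂μ ≤ η := by
  intro L
  induction L with
  | nil =>
    intro _ _ η hη
    obtain ⟨b, hb, hK, hb2, hle⟩ := exists_bdd_cont_sq_le μ hh hη
    exact ⟨b, hb, hK, hb2, fun e he => by simp at he, hle⟩
  | cons e L ih =>
    intro hL horth η hη
    have he2 : MemLp e 2 μ := hL e (List.mem_cons.2 (Or.inl rfl))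
    have hL' : ∀ e' ∈ L, MemLp e' 2 μ := fun e' he' => hL e' (List.mem_cons.2 (Or.inr he'))
    have horth' : ∀ e' ∈ L, ∫ v, h v * e' v ∂μ = 0 := fun e' he' =>
      horth e' (List.mem_cons.2 (Or.inr he'))
    have hhe : ∫ v, h v * e v ∂μ = 0 := horth e (List.mem_cons.2 (Or.inl rfl))
    by_cases hB : ∃ b₀ : V3 → ℝ, Continuous b₀ ∧ (∃ K : ℝ, ∀ v, |b₀ v| ≤ K) ∧ MemLp b₀ 2 μ ∧
        (∀ e' ∈ L, ∫ v, b₀ v * e' v ∂μ = 0) ∧ ∫ v, b₀ v * e v ∂μ ≠ 0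
    · -- correct the approximant by a multiple of `b₀`
      obtain ⟨b₀, hb₀, ⟨K₀, hK₀⟩, hb₀2, hb₀L, hβ⟩ := hB
      have hM0 : 0 ≤ (∫ v, e v ^ 2 ∂μ) * (∫ v, b₀ v ^ 2 ∂μ) / (∫ v, b₀ v * e v ∂μ) ^ 2 :=
        div_nonneg (mul_nonneg (integral_nonneg fun _ => sq_nonneg _)
          (integral_nonneg fun _ => sq_nonneg _)) (sq_nonneg _)
      have hη' : 0 < η / (2 + 2 * ((∫ v, e v ^ 2 ∂μ) * (∫ v, b₀ v ^ 2 ∂μ) /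
          (∫ v, b₀ v * e v ∂μ) ^ 2)) := by positivity
      obtain ⟨b, hb, ⟨K, hK⟩, hb2, hbL, hle⟩ := ih hL' horth' _ hη'
      refine ⟨fun v => b v - (∫ w, b w * e w ∂μ) / (∫ w, b₀ w * e w ∂μ) * b₀ v,
        hb.sub (continuous_const.mul hb₀),
        ⟨K + |(∫ w, b w * e w ∂μ) / (∫ w, b₀ w * e w ∂μ)| * K₀, fun v => ?_⟩,
        hb2.sub (hb₀2.const_mul _), fun e' he' => ?_, ?_⟩
      · calc |b v - (∫ w, b w * e w ∂μ) / (∫ w, b₀ w * e w ∂μ) * b₀ v|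
            ≤ |b v| + |(∫ w, b w * e w ∂μ) / (∫ w, b₀ w * e w ∂μ) * b₀ v| := abs_sub _ _
          _ = |b v| + |(∫ w, b w * e w ∂μ) / (∫ w, b₀ w * e w ∂μ)| * |b₀ v| := by rw [abs_mul]
          _ ≤ K + |(∫ w, b w * e w ∂μ) / (∫ w, b₀ w * e w ∂μ)| * K₀ :=
            add_le_add (hK v) (mul_le_mul_of_nonneg_left (hK₀ v) (abs_nonneg _))
      · -- orthogonality to `e :: L`
        have he'2 : MemLp e' 2 μ := hL e' he'
        have hi1 : Integrable (fun v => b v * e' v) μ := hb2.integrable_mul he'2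
        have hi2 : Integrable (fun v => b₀ v * e' v) μ := hb₀2.integrable_mul he'2
        have hsplit : ∫ v, (b v - (∫ w, b w * e w ∂μ) / (∫ w, b₀ w * e w ∂μ) * b₀ v) * e' v ∂μ =
            ∫ v, b v * e' v ∂μ -
              (∫ w, b w * e w ∂μ) / (∫ w, b₀ w * e w ∂μ) * ∫ v, b₀ v * e' v ∂μ := by
          have h1 : ∫ v, (b v - (∫ w, b w * e w ∂μ) / (∫ w, b₀ w * e w ∂μ) * b₀ v) * e' v ∂μ =
              ∫ v, (b v * e' v -
                (∫ w, b w * e w ∂μ) / (∫ w, b₀ w * e w ∂μ) * (b₀ v * e' v)) ∂μ :=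
            integral_congr_ae (Eventually.of_forall fun v => by ring)
          rw [h1, integral_sub hi1 (hi2.const_mul _), integral_const_mul]
        rw [hsplit]
        rcases List.mem_cons.1 he' with rfl | hmem
        · rw [div_mul_cancel₀ _ hβ, sub_self]
        · rw [hbL e' hmem, hb₀L e' hmem, mul_zero, sub_zero]
      · -- distance: `(x + y)² ≤ 2x² + 2y²` and Cauchy–Schwarz
        have hhb : MemLp (fun v => h v - b v) 2 μ := hh.sub hb2
        have hcb₀ : MemLp (fun v => (∫ w, b w * e w ∂μ) / (∫ w, b₀ w * e w ∂μ) * b₀ v) 2 μ :=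
          hb₀2.const_mul _
        have hI1 : Integrable
            (fun v => (h v - (b v - (∫ w, b w * e w ∂μ) / (∫ w, b₀ w * e w ∂μ) * b₀ v)) ^ 2) μ :=
          (hh.sub (hb2.sub hcb₀)).integrable_sq
        have hD : Integrable (fun v => (h v - b v) ^ 2) μ := hhb.integrable_sq
        have hY : Integrable
            (fun v => ((∫ w, b w * e w ∂μ) / (∫ w, b₀ w * e w ∂μ) * b₀ v) ^ 2) μ :=
          hcb₀.integrable_sq
        have hB₀ : Integrable (fun v => b₀ v ^ 2) μ := hb₀2.integrable_sq
        have hbe : ∫ v, b v * e v ∂μ = -∫ v, (h v - b v) * e v ∂μ := by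
          have h1 : ∫ v, (h v - b v) * e v ∂μ = ∫ v, (h v * e v - b v * e v) ∂μ :=
            integral_congr_ae (Eventually.of_forall fun v => by ring)
          have hi1 : Integrable (fun v => h v * e v) μ := hh.integrable_mul he2
          have hi2 : Integrable (fun v => b v * e v) μ := hb2.integrable_mul he2
          rw [h1, integral_sub hi1 hi2, hhe, zero_sub, neg_neg]
        have hCS := sq_integral_mul_le hhb he2
        have hβ2 : 0 < (∫ v, b₀ v * e v ∂μ) ^ 2 := by positivity
        have hc2 : ((∫ w, b w * e w ∂μ) / (∫ w, b₀ w * e w ∂μ)) ^ 2 * ∫ v, b₀ v ^ 2 ∂μ ≤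
            (∫ v, (h v - b v) ^ 2 ∂μ) * ((∫ v, e v ^ 2 ∂μ) * (∫ v, b₀ v ^ 2 ∂μ) /
              (∫ v, b₀ v * e v ∂μ) ^ 2) := by
          rw [div_pow, hbe, neg_sq]
          calc (∫ v, (h v - b v) * e v ∂μ) ^ 2 / (∫ v, b₀ v * e v ∂μ) ^ 2 * ∫ v, b₀ v ^ 2 ∂μ
              ≤ (∫ v, (h v - b v) ^ 2 ∂μ) * (∫ v, e v ^ 2 ∂μ) / (∫ v, b₀ v * e v ∂μ) ^ 2 *
                  ∫ v, b₀ v ^ 2 ∂μ := by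
                gcongr
            _ = _ := by ring
        calc ∫ v, (h v - (b v - (∫ w, b w * e w ∂μ) / (∫ w, b₀ w * e w ∂μ) * b₀ v)) ^ 2 ∂μ
            ≤ ∫ v, (2 * (h v - b v) ^ 2 +
                2 * ((∫ w, b w * e w ∂μ) / (∫ w, b₀ w * e w ∂μ) * b₀ v) ^ 2) ∂μ := by
              refine integral_mono hI1 ((hD.const_mul 2).add (hY.const_mul 2)) fun v => ?_
              show (h v - (b v - (∫ w, b w * e w ∂μ) / (∫ w, b₀ w * e w ∂μ) * b₀ v)) ^ 2 ≤
                2 * (h v - b v) ^ 2 + 2 * ((∫ w, b w * e w ∂μ) / (∫ w, b₀ w * e w ∂μ) * b₀ v) ^ 2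
              nlinarith [sq_nonneg (h v - b v -
                (∫ w, b w * e w ∂μ) / (∫ w, b₀ w * e w ∂μ) * b₀ v)]
          _ = 2 * ∫ v, (h v - b v) ^ 2 ∂μ +
                2 * (((∫ w, b w * e w ∂μ) / (∫ w, b₀ w * e w ∂μ)) ^ 2 * ∫ v, b₀ v ^ 2 ∂μ) := by
              rw [integral_add (hD.const_mul 2) (hY.const_mul 2), integral_const_mul,
                integral_const_mul, ← integral_const_mul (_ ^ 2) fun v => b₀ v ^ 2]
              congr 2
              refine integral_congr_ae (Eventually.of_forall fun v => ?_)
              simp only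
              ring
          _ ≤ 2 * ∫ v, (h v - b v) ^ 2 ∂μ + 2 * ((∫ v, (h v - b v) ^ 2 ∂μ) *
                ((∫ v, e v ^ 2 ∂μ) * (∫ v, b₀ v ^ 2 ∂μ) / (∫ v, b₀ v * e v ∂μ) ^ 2)) := by
              gcongr
          _ = (∫ v, (h v - b v) ^ 2 ∂μ) * (2 + 2 * ((∫ v, e v ^ 2 ∂μ) * (∫ v, b₀ v ^ 2 ∂μ) /
                (∫ v, b₀ v * e v ∂μ) ^ 2)) := by ring
          _ ≤ η / (2 + 2 * ((∫ v, e v ^ 2 ∂μ) * (∫ v, b₀ v ^ 2 ∂μ) /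
                (∫ v, b₀ v * e v ∂μ) ^ 2)) * (2 + 2 * ((∫ v, e v ^ 2 ∂μ) *
                  (∫ v, b₀ v ^ 2 ∂μ) / (∫ v, b₀ v * e v ∂μ) ^ 2)) := by
              gcongr
          _ = η := div_mul_cancel₀ η (by positivity)
    · -- `φ_e` vanishes on the bounded continuous functions orthogonal to `L`: nothing to do
      push Not at hB
      obtain ⟨b, hb, hK, hb2, hbL, hle⟩ := ih hL' horth' η hη
      refine ⟨b, hb, hK, hb2, fun e' he' => ?_, hle⟩
      rcases List.mem_cons.1 he' with rfl | hmem
      · exact hB b hb hK hb2 hbL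
      · exact hbL e' hmem

/-! ### The Gaussian velocity law and the five collision invariants -/

/-- **Density of bounded continuous profiles `⊥ {1, v, |v|²}`.** For `θ > 0`, a continuous
polynomially bounded `h` that is `M_θ`-orthogonal to `1, v₁, v₂, v₃, |v|²`, and `ε > 0`, there is a
bounded continuous `g`, `M_θ`-orthogonal to the same five functions, with `∫ (h - g)² M_θ ≤ ε`
(finite-codimension density in `L²(gaussMeasure 0 θ)`). [folklore] -/
theorem exists_bdd_cont_orth_five {θ : ℝ} (hθ : 0 < θ) {h : V3 → ℝ} (hh : Continuous h) {C : ℝ}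
    {k : ℕ} (hCk : ∀ v, |h v| ≤ C * (1 + ‖v‖) ^ k)
    (h1 : ∫ v, h v * localMaxwellian 1 θ (0 : V3) v = 0)
    (hv : ∀ i : Fin 3, ∫ v, h v * v i * localMaxwellian 1 θ (0 : V3) v = 0)
    (hE : ∫ v, h v * ‖v‖ ^ 2 * localMaxwellian 1 θ (0 : V3) v = 0) {ε : ℝ} (hε : 0 < ε) :
    ∃ g : V3 → ℝ, Continuous g ∧ (∃ K : ℝ, ∀ v, |g v| ≤ K) ∧
      (∫ v, g v * localMaxwellian 1 θ (0 : V3) v = 0) ∧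
      (∀ i : Fin 3, ∫ v, g v * v i * localMaxwellian 1 θ (0 : V3) v = 0) ∧
      (∫ v, g v * ‖v‖ ^ 2 * localMaxwellian 1 θ (0 : V3) v = 0) ∧
      ∫ v, (h v - g v) ^ 2 * localMaxwellian 1 θ (0 : V3) v ≤ ε := by
  have hh2 : MemLp h 2 (gaussMeasure (0 : V3) θ) := memLp_two_gaussMeasure_of_poly_growth θ hh hCk
  -- the five test functions, all in `L²(gaussMeasure 0 θ)`
  have he₀2 : MemLp (fun _ : V3 => (1 : ℝ)) 2 (gaussMeasure (0 : V3) θ) := memLp_const 1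
  have he₄2 : MemLp (fun v : V3 => ‖v‖ ^ 2) 2 (gaussMeasure (0 : V3) θ) :=
    memLp_two_gaussMeasure_of_poly_growth θ (C := 1) (k := 2) (continuous_norm.pow 2) fun v => by
      rw [abs_pow, abs_norm, one_mul]
      exact pow_le_pow_left₀ (norm_nonneg _) (by linarith [norm_nonneg v]) 2
  have hec2 : ∀ i : Fin 3, MemLp (fun v : V3 => v i) 2 (gaussMeasure (0 : V3) θ) := fun i =>
    memLp_two_gaussMeasure_of_poly_growth θ (C := 1) (k := 1) (PiLp.continuous_apply 2 _ i)
      fun v => by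
        rw [one_mul, pow_one, ← Real.norm_eq_abs]
        exact (PiLp.norm_apply_le v i).trans (by linarith [norm_nonneg v])
  have hLmem : ∀ e ∈ (fun _ : V3 => (1 : ℝ)) :: (fun v : V3 => ‖v‖ ^ 2) ::
      List.ofFn (fun (i : Fin 3) (v : V3) => v i), MemLp e 2 (gaussMeasure (0 : V3) θ) := by
    intro e he
    simp only [List.mem_cons, List.mem_ofFn] at he
    rcases he with rfl | rfl | ⟨i, rfl⟩
    exacts [he₀2, he₄2, hec2 i]
  have hLorth : ∀ e ∈ (fun _ : V3 => (1 : ℝ)) :: (fun v : V3 => ‖v‖ ^ 2) ::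
      List.ofFn (fun (i : Fin 3) (v : V3) => v i),
      ∫ v, h v * e v ∂(gaussMeasure (0 : V3) θ) = 0 := by
    intro e he
    simp only [List.mem_cons, List.mem_ofFn] at he
    rcases he with rfl | rfl | ⟨i, rfl⟩
    · simp only [mul_one]
      rw [integral_gaussMeasure_eq_integral_mul hθ]
      exact h1
    · rw [integral_gaussMeasure_eq_integral_mul hθ]
      exact hE
    · rw [integral_gaussMeasure_eq_integral_mul hθ]
      exact hv i
  obtain ⟨g, hg, hK, -, hgL, hle⟩ :=
    exists_bdd_cont_orth (gaussMeasure (0 : V3) θ) hh2 _ hLmem hLorth ε hε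
  refine ⟨g, hg, hK, ?_, fun i => ?_, ?_, ?_⟩
  · have h0 := hgL (fun _ : V3 => (1 : ℝ)) (List.mem_cons.2 (Or.inl rfl))
    simp only [mul_one] at h0
    rwa [integral_gaussMeasure_eq_integral_mul hθ] at h0
  · have h0 := hgL (fun v : V3 => v i)
      (List.mem_cons.2 (Or.inr (List.mem_cons.2 (Or.inr (List.mem_ofFn.2 ⟨i, rfl⟩)))))
    rwa [integral_gaussMeasure_eq_integral_mul hθ] at h0
  · have h0 := hgL (fun v : V3 => ‖v‖ ^ 2) (List.mem_cons.2 (Or.inr (List.mem_cons.2 (Or.inl rfl))))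
    rwa [integral_gaussMeasure_eq_integral_mul hθ] at h0
  · rwa [integral_gaussMeasure_eq_integral_mul hθ] at hle

end stub_profileDensityAllAux

end Summit.AtomisticToContinuum.HydrodynamicLimit.Theorems.MourreKoopmanChargesOneBodyCompleteness

end
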